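import Summits.CriticalPhenomena.PercolationContinuityZ3.Theorems.Transplant.SkeletonDegreeObstruction
import Summits.CriticalPhenomena.PercolationContinuityZ3.Theorems.Transplant.PlanarSkeletonFrmDefs
import Summits.CriticalPhenomena.PercolationContinuityZ3.Theorems.Transplant.KagomeAut
import HarnessLib

/-!
# A DEGREE / TRIANGLE OBSTRUCTION to the outward-step field (ι) of every planar-skeleton interface — and the 2D KAGOME lattice (bond) as a
# KERNEL method-void row: `IsEmpty (PlanarSkeletonNeg kagomeGraph)`

builds on p205010 (kernel theorem, internal audit signed; external expert review pending) — nothing in this file uses p205010.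
Lane `prim-bschramm`, seat `prim-bschramm-p2` (gen 18; class C1b by INPUT SUBSTITUTION); helper file (`--supports stmt-CriticalPhenomena-4575`).
Memo `HOME/bschramm/P2-LATTICES.md` §46.

THE OBSERVATION.  Every skeleton interface of the lane with a planar `φ : V → ℤ²` (`PlanarSkeletonFrm`, `PlanarSkeletonNeg` — hence
`PlanarSkeletonSign`, the closed D″ / N1 nodes' input — and `PlanarSkeletonConc`) carries the field
(ι) `step : ∀ v i σ, ∃ v', v ∼ v' ∧ φ v' = φ v + σ e_i`.  The four targets `φ v ± e₀, φ v ± e₁` are distinct, so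
(1) every vertex has degree `≥ 4` — gen 10's `SkeletonDegreeObstruction` (`PlanarSkeletonNeg.four_le_degree`, the (111)-films and the honeycomb
    lattice as kernel negatives); restated here for a bare step field (`four_le_degree_of_unitSteps`) and extended to `PlanarSkeletonFrm`;
(2) at a vertex of degree EXACTLY `4` every neighbour sits at a unit target, so the coordinate sum `φ₀ + φ₁` changes by `±1` along every
    bond at such a vertex (`coordSum_step_of_degree_le`); around a TRIANGLE whose three vertices have degree `≤ 4` the three changes are odd
    and sum to zero — impossible (**`false_of_triangle_of_unitSteps`**).  No Lipschitz property, frame, symmetry or cylinder is used.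
CONSEQUENCE (the gen-17 open cell "2D kagome BOND row at its own p_c"): the kagome lattice `kagomeGraph` is 4-regular
(`degree_kagomeGraph_holds`) and the three edge midpoints of an up-triangle of `𝕋`, `(x,0), (x,1), (x,2)`, are pairwise adjacent
(`KagZ.adj_cell`); hence **`isEmpty_planarSkeletonNeg_kagome`**, `isEmpty_planarSkeletonSign_kagome`, `isEmpty_planarSkeletonConc_kagome`,
`isEmpty_planarSkeletonFrm_kagome`: bond percolation on the 2D kagome lattice is METHOD-VOID for every planar-skeleton node of the lane, as a
kernel statement (the same holds for `(3,4,6,4)` and for every 4-regular net of corner-sharing triangles, e.g. hyperkagome).  NOT affected: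
the one-dimensional `LineSkeletonNeg` (the stacked kagome lattice `kagomeGraph □ ℤ` IS a customer, `KagomeZSign`: the vertical bonds supply
the second direction and raise the degree to `6`), and SITE percolation on kagome (PROVED, `kagome_siteCriticalContinuity`, via the covering-graph
device).  In print `θ^{bond}_{kagome}(p_c) = 0` is within Kesten's 1982 theory of periodic planar lattices with axes of symmetry; the tree has no
planar-duality / RSW device for it.
[cite: KozmaNitzan2024, §4 p. 16 (Lemma 8: the lattice symmetries)] [cite: Kesten1982, §3.3 Thm. 3.1] [cite: SavaryBalents2017, §5]
-/

noncomputable section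

namespace Summit.CriticalPhenomena.PercolationContinuityZ3.Theorems.Transplant

open Literature.Probability.Percolation Literature.Probability.LatticeModels SimpleGraph
open Literature.MathematicalPhysics.QuantumLattice
open scoped Classical

/-! ## §1 Unit steps in `ℤ²`: four distinct targets, odd coordinate sums -/

section UnitSteps

variable {V : Type} {G : SimpleGraph V} [G.LocallyFinite] {φ : V → Site 2}

/-- The coordinate sum of `σ e_i` is `σ`. [folklore] -/
theorem coordSum_single (i : Fin 2) (σ : ℤ) :
    (Pi.single i σ : Site 2) 0 + (Pi.single i σ : Site 2) 1 = σ := by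
  fin_cases i <;> simp

/-- Along a unit step the coordinate sum `φ₀ + φ₁` changes by `±1`. [folklore] -/
theorem coordSum_of_step {v u : V} {i : Fin 2} {σ : ℤˣ} (h : φ u = φ v + Pi.single i (σ : ℤ)) :
    (φ u 0 + φ u 1) - (φ v 0 + φ v 1) = 1 ∨ (φ u 0 + φ u 1) - (φ v 0 + φ v 1) = -1 := by
  have e : (φ u 0 + φ u 1) - (φ v 0 + φ v 1) = (σ : ℤ) := by
    have h0 := congrFun h 0
    have h1 := congrFun h 1
    simp only [Pi.add_apply] at h0 h1
    rw [h0, h1]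
    have := coordSum_single i (σ : ℤ)
    linarith
  rw [e]
  rcases Int.units_eq_one_or σ with hσ | hσ
  · exact Or.inl (by rw [hσ]; rfl)
  · exact Or.inr (by rw [hσ]; rfl)

variable (hstep : ∀ (v : V) (i : Fin 2) (σ : ℤˣ), ∃ v' : V, G.Adj v v' ∧ φ v' = φ v + Pi.single i (σ : ℤ))
include hstep

/-- **The four step targets give four distinct neighbours**: a `Finset` of four neighbours of `v` with `φ`-values `φ v ± e₀`, `φ v ± e₁`,
and every vertex of such a `Finset` is at a unit target. [folklore] -/
theorem exists_four_neighbors (v : V) :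
    ∃ S : Finset V, S.card = 4 ∧ S ⊆ G.neighborFinset v ∧
      ∀ u ∈ S, ∃ (i : Fin 2) (σ : ℤˣ), φ u = φ v + Pi.single i (σ : ℤ) := by
  obtain ⟨a, ha, hφa⟩ := hstep v 0 1
  obtain ⟨b, hb, hφb⟩ := hstep v 0 (-1)
  obtain ⟨c, hc, hφc⟩ := hstep v 1 1
  obtain ⟨d, hd, hφd⟩ := hstep v 1 (-1)
  -- the four targets are pairwise distinct points of `ℤ²`
  have hab : a ≠ b := by
    intro h; subst h
    have := congrFun (hφa.symm.trans hφb) 0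
    simp at this
  have hac : a ≠ c := by
    intro h; subst h
    have := congrFun (hφa.symm.trans hφc) 0
    simp at this
  have had : a ≠ d := by
    intro h; subst h
    have := congrFun (hφa.symm.trans hφd) 0
    simp at this
  have hbc : b ≠ c := by
    intro h; subst h
    have := congrFun (hφb.symm.trans hφc) 0
    simp at this
  have hbd : b ≠ d := by
    intro h; subst h
    have := congrFun (hφb.symm.trans hφd) 0
    simp at this
  have hcd : c ≠ d := by
    intro h; subst h
    have := congrFun (hφc.symm.trans hφd) 1
    simp at this
  refine ⟨{a, b, c, d}, ?_, ?_, ?_⟩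
  · rw [Finset.card_insert_of_notMem (by simp [hab, hac, had]), Finset.card_insert_of_notMem (by simp [hbc, hbd]),
      Finset.card_pair hcd]
  · intro u hu
    simp only [Finset.mem_insert, Finset.mem_singleton] at hu
    rw [mem_neighborFinset]
    rcases hu with rfl | rfl | rfl | rfl
    exacts [ha, hb, hc, hd]
  · intro u hu
    simp only [Finset.mem_insert, Finset.mem_singleton] at hu
    rcases hu with rfl | rfl | rfl | rfl
    exacts [⟨0, 1, hφa⟩, ⟨0, -1, hφb⟩, ⟨1, 1, hφc⟩, ⟨1, -1, hφd⟩]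

/-- **(1) Every vertex has degree at least `4`** under the outward-step field (ι). [folklore] -/
theorem four_le_degree_of_unitSteps (v : V) : 4 ≤ G.degree v := by
  obtain ⟨S, hS, hSsub, -⟩ := exists_four_neighbors hstep v
  rw [← card_neighborFinset_eq_degree, ← hS]
  exact Finset.card_le_card hSsub

/-- **(2) At a vertex of degree `≤ 4` every neighbour sits at a unit target.** [folklore] -/
theorem exists_step_of_degree_le {v u : V} (hv : G.degree v ≤ 4) (h : G.Adj v u) :
    ∃ (i : Fin 2) (σ : ℤˣ), φ u = φ v + Pi.single i (σ : ℤ) := by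
  obtain ⟨S, hS, hSsub, hSφ⟩ := exists_four_neighbors hstep v
  have hSeq : S = G.neighborFinset v :=
    Finset.eq_of_subset_of_card_le hSsub (by rw [card_neighborFinset_eq_degree, hS]; exact hv)
  exact hSφ u (by rw [hSeq, mem_neighborFinset]; exact h)

/-- At a vertex of degree `≤ 4`, the coordinate sum `φ₀ + φ₁` changes by `±1` along EVERY bond. [folklore] -/
theorem coordSum_step_of_degree_le {v u : V} (hv : G.degree v ≤ 4) (h : G.Adj v u) :
    (φ u 0 + φ u 1) - (φ v 0 + φ v 1) = 1 ∨ (φ u 0 + φ u 1) - (φ v 0 + φ v 1) = -1 := by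
  obtain ⟨i, σ, hφ⟩ := exists_step_of_degree_le hstep hv h
  exact coordSum_of_step hφ

/-- **THE TRIANGLE OBSTRUCTION**: under the outward-step field (ι), no triangle of `G` has all three vertices of degree `≤ 4` (the three
changes of `φ₀ + φ₁` around it would be odd and sum to zero). [folklore] -/
theorem false_of_triangle_of_unitSteps {u v w : V} (huv : G.Adj u v) (hvw : G.Adj v w) (hwu : G.Adj w u)
    (hu : G.degree u ≤ 4) (hv : G.degree v ≤ 4) (hw : G.degree w ≤ 4) : False := by
  have h1 := coordSum_step_of_degree_le hstep hu huv
  have h2 := coordSum_step_of_degree_le hstep hv hvw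
  have h3 := coordSum_step_of_degree_le hstep hw hwu
  omega

end UnitSteps

/-! ## §2 The obstruction for the four planar-skeleton interfaces -/

section Interfaces

variable {V : Type} {G : SimpleGraph V} [G.LocallyFinite]

/-- **No `PlanarSkeletonNeg` on a graph with a triangle of vertices of degree `≤ 4`.** [folklore] -/
theorem isEmpty_planarSkeletonNeg_of_triangle {u v w : V} (huv : G.Adj u v) (hvw : G.Adj v w) (hwu : G.Adj w u)
    (hu : G.degree u ≤ 4) (hv : G.degree v ≤ 4) (hw : G.degree w ≤ 4) : IsEmpty (PlanarSkeletonNeg G) :=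
  ⟨fun Φ => false_of_triangle_of_unitSteps Φ.step huv hvw hwu hu hv hw⟩

/-- … hence no `PlanarSkeletonSign` (the closed D″ nodes' input) either. [folklore] -/
theorem isEmpty_planarSkeletonSign_of_triangle {u v w : V} (huv : G.Adj u v) (hvw : G.Adj v w) (hwu : G.Adj w u)
    (hu : G.degree u ≤ 4) (hv : G.degree v ≤ 4) (hw : G.degree w ≤ 4) : IsEmpty (PlanarSkeletonSign G) :=
  ⟨fun Φ => (isEmpty_planarSkeletonNeg_of_triangle huv hvw hwu hu hv hw).false Φ.toPlanarSkeletonNeg⟩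

/-- … and no `PlanarSkeletonConc` (the node of record's input; `toNeg`). [folklore] -/
theorem isEmpty_planarSkeletonConc_of_triangle {u v w : V} (huv : G.Adj u v) (hvw : G.Adj v w) (hwu : G.Adj w u)
    (hu : G.degree u ≤ 4) (hv : G.degree v ≤ 4) (hw : G.degree w ≤ 4) : IsEmpty (PlanarSkeletonConc G) :=
  ⟨fun Φ => (isEmpty_planarSkeletonNeg_of_triangle huv hvw hwu hu hv hw).false Φ.toNeg⟩

/-- … and no `PlanarSkeletonFrm` (the frames-only interface). [folklore] -/
theorem isEmpty_planarSkeletonFrm_of_triangle {u v w : V} (huv : G.Adj u v) (hvw : G.Adj v w) (hwu : G.Adj w u)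
    (hu : G.degree u ≤ 4) (hv : G.degree v ≤ 4) (hw : G.degree w ≤ 4) : IsEmpty (PlanarSkeletonFrm G) :=
  ⟨fun Φ => false_of_triangle_of_unitSteps Φ.step huv hvw hwu hu hv hw⟩

/-- No `PlanarSkeletonFrm` on a graph with a vertex of degree `≤ 3`. [folklore] -/
theorem isEmpty_planarSkeletonFrm_of_degree_le_three {v : V} (hv : G.degree v ≤ 3) : IsEmpty (PlanarSkeletonFrm G) :=
  ⟨fun Φ => absurd (four_le_degree_of_unitSteps Φ.step v) (by omega)⟩

end Interfaces

/-! ## §3 The 2D kagome lattice (bond): method-void for every planar-skeleton node, as a kernel statement -/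

/-- The three edge midpoints of the up-triangle of the cell `x` form a triangle of the kagome lattice. [cite: SavaryBalents2017, §5] -/
theorem kagome_triangle (x : Site 2) :
    kagomeGraph.Adj (x, 0) (x, 1) ∧ kagomeGraph.Adj (x, 1) (x, 2) ∧ kagomeGraph.Adj (x, 2) (x, 0) :=
  ⟨KagZ.adj_cell x (by decide), KagZ.adj_cell x (by decide), KagZ.adj_cell x (by decide)⟩

/-- **THEOREM (kernel no-go): the 2D kagome lattice carries no `PlanarSkeletonNeg`** — it is 4-regular (`degree_kagomeGraph_holds`) and every
bond lies in a triangle. [cite: SavaryBalents2017, §5] [cite: KozmaNitzan2024, §4 p. 16 (Lemma 8)] -/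
theorem isEmpty_planarSkeletonNeg_kagome : IsEmpty (PlanarSkeletonNeg kagomeGraph) := by
  obtain ⟨h01, h12, h20⟩ := kagome_triangle 0
  exact isEmpty_planarSkeletonNeg_of_triangle h01 h12 h20 (degree_kagomeGraph_holds _).le (degree_kagomeGraph_holds _).le
    (degree_kagomeGraph_holds _).le

/-- **… no `PlanarSkeletonSign`** (so neither D″ node `samePDropOfSkeletonSign(₁)_holds` nor the N1 node has the 2D kagome lattice as a customer).
[cite: SavaryBalents2017, §5] -/
theorem isEmpty_planarSkeletonSign_kagome : IsEmpty (PlanarSkeletonSign kagomeGraph) := by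
  obtain ⟨h01, h12, h20⟩ := kagome_triangle 0
  exact isEmpty_planarSkeletonSign_of_triangle h01 h12 h20 (degree_kagomeGraph_holds _).le (degree_kagomeGraph_holds _).le
    (degree_kagomeGraph_holds _).le

/-- **… no `PlanarSkeletonConc`** (the node of record `samePDropOfSkeletonConcLt_holds`). [cite: SavaryBalents2017, §5] -/
theorem isEmpty_planarSkeletonConc_kagome : IsEmpty (PlanarSkeletonConc kagomeGraph) := by
  obtain ⟨h01, h12, h20⟩ := kagome_triangle 0
  exact isEmpty_planarSkeletonConc_of_triangle h01 h12 h20 (degree_kagomeGraph_holds _).le (degree_kagomeGraph_holds _).le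
    (degree_kagomeGraph_holds _).le

/-- **… and no `PlanarSkeletonFrm`** (the frames-only interface of the N2 scoping). [cite: SavaryBalents2017, §5] -/
theorem isEmpty_planarSkeletonFrm_kagome : IsEmpty (PlanarSkeletonFrm kagomeGraph) := by
  obtain ⟨h01, h12, h20⟩ := kagome_triangle 0
  exact isEmpty_planarSkeletonFrm_of_triangle h01 h12 h20 (degree_kagomeGraph_holds _).le (degree_kagomeGraph_holds _).le
    (degree_kagomeGraph_holds _).le

end Summit.CriticalPhenomena.PercolationContinuityZ3.Theorems.Transplant

end
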